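import Mathlib
import Summits.Ventures.PercRepro.TriangleCapRowTopLayers

/-!
# PercRepro — THE SHARP BAND BOUND ON `n` VERTICES (p3, gen 51; part 243)

For a triangle-free graph on `n` vertices with `s` edges at a band-`t` value with star centre `w` (`deg w = s − t`),
the `ℓ = n − 1 − (s − t)` non-neighbours `L` of `w` carry `Σ_{x ∈ L} offDeg x = 2 t − attach` incidences of the `t`
off-edges (`sum_offDeg_add_attach`: an off-edge has its two ends in `L ∪ N(w)`, at most one in `N(w)`).  The
tangent-line bound at any `q ≥ 1` then gives

  **`2 j + 2 q t ≤ t (t − 1) + ℓ q (q + 1)`**   (`band_bound_vertices_sharp`),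

`2 t` better than part 240's bound; at `q = ⌊t / ℓ⌋` with `ℓ < t` it reads `j ≤ C(t, 2) − ℓ C(q, 2) − ρ q` (the
row-witness value with every off-pair at a leaf; its realisation on exactly `ℓ + 1 + (s − t)` vertices needs the
row witness without spare right vertices — left to a successor).  Axioms: standard.
-/

namespace PercRepro

namespace TriangleCap

namespace C047

open Finset

variable {V : Type*} [Fintype V] [DecidableEq V]

/-- An off-edge at `w` meets `L = V ∖ N[w]` in `2 − |N(w) ∩ e|` vertices. -/
theorem card_filter_nonneighbour_add (H : SimpleGraph V) [DecidableRel H.Adj] (w : V)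
    (e : Sym2 V) (he : e ∈ offEdges H w) :
    ((univ.filter (fun v => ¬ H.Adj w v ∧ v ≠ w)).filter (fun x => x ∈ e)).card +
      (univ.filter (fun v => H.Adj w v ∧ v ∈ e)).card = 2 := by
  rw [mem_offEdges, SimpleGraph.mem_edgeFinset] at he
  obtain ⟨he, hwe⟩ := he
  revert he hwe
  refine Sym2.ind (fun x y he hwe => ?_) e
  rw [SimpleGraph.mem_edgeSet] at he
  rw [Sym2.mem_iff] at hwe
  have hxy : x ≠ y := H.ne_of_adj he
  have hxw : x ≠ w := fun h => hwe (Or.inl h.symm)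
  have hyw : y ≠ w := fun h => hwe (Or.inr h.symm)
  -- the two filters partition `{x, y}`
  have e1 : (univ.filter (fun v => ¬ H.Adj w v ∧ v ≠ w)).filter (fun v => v ∈ s(x, y)) =
      ({x, y} : Finset V).filter (fun v => ¬ H.Adj w v) := by
    ext v
    simp only [mem_filter, mem_univ, true_and, Sym2.mem_iff, mem_insert, mem_singleton]
    constructor
    · rintro ⟨⟨h1, -⟩, h2⟩
      exact ⟨h2, h1⟩
    · rintro ⟨h2, h1⟩
      refine ⟨⟨h1, ?_⟩, h2⟩
      rcases h2 with rfl | rfl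
      · exact hxw
      · exact hyw
  have e2 : univ.filter (fun v => H.Adj w v ∧ v ∈ s(x, y)) = ({x, y} : Finset V).filter (fun v => H.Adj w v) := by
    ext v
    simp only [mem_filter, mem_univ, true_and, Sym2.mem_iff, mem_insert, mem_singleton]
    tauto
  rw [e1, e2, add_comm, card_filter_add_card_filter_not, card_pair hxy]

/-- **`Σ_{x ∈ L} offDeg x + attach = 2 t`** over the non-neighbourhood `L` of `w`. -/
theorem sum_offDeg_add_attach (H : SimpleGraph V) [DecidableRel H.Adj] (w : V) :
    ∑ x ∈ univ.filter (fun v => ¬ H.Adj w v ∧ v ≠ w), offDeg H w x + attach H w = 2 * (offEdges H w).card := by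
  rw [attach_eq_sum_card]
  unfold offDeg
  simp_rw [card_filter]
  rw [sum_comm, ← sum_add_distrib, card_eq_sum_ones, mul_sum]
  apply sum_congr rfl
  intro e he
  have := card_filter_nonneighbour_add H w e he
  rw [card_filter, card_filter] at this
  omega

/-- **THE SHARP BAND BOUND ON `n` VERTICES** (`1 ≤ q`): at a band-`t` value with star centre `w` of degree
`s − t ≥ 1`, `2 j + 2 q t ≤ t (t − 1) + (n − 1 − (s − t)) q (q + 1)`. -/
theorem band_bound_vertices_sharp (H : SimpleGraph V) [DecidableRel H.Adj] (hfree : H.CliqueFree 3) (s t j : ℕ)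
    (hm : H.edgeFinset.card = s) (w : V) (hw : 1 ≤ deg H w) (ht : (offEdges H w).card = t)
    (hS : ∑ v, deg H v * deg H v + 2 * (t * (s - t - 1)) + 2 * j = s * (s + 1)) (q : ℕ) (hq : 1 ≤ q) :
    2 * j + 2 * q * t ≤ t * (t - 1) + (Fintype.card V - 1 - (s - t)) * (q * (q + 1)) := by
  set L := univ.filter (fun v => ¬ H.Adj w v ∧ v ≠ w) with hLdef
  have hwL : w ∉ L := by simp [hLdef]
  have hLcard : L.card = Fintype.card V - 1 - (s - t) := by
    have hcard := card_offEdges_add_deg H w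
    rw [ht, hm] at hcard
    have h1 : L.card + (univ.filter (fun v => H.Adj w v)).card + 1 = Fintype.card V := by
      have hsplit := card_filter_add_card_filter_not (s := (univ : Finset V)) (fun v => H.Adj w v)
      rw [card_univ] at hsplit
      have h2 : (univ.filter (fun v => ¬ H.Adj w v)).card = L.card + 1 := by
        have : univ.filter (fun v => ¬ H.Adj w v) = insert w L := by
          ext v
          simp only [hLdef, mem_filter, mem_univ, true_and, mem_insert]
          constructor
          · intro h
            by_cases hv : v = w
            · exact Or.inl hv
            · exact Or.inr ⟨h, hv⟩
          · rintro (rfl | ⟨h, -⟩)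
            · exact H.irrefl
            · exact h
        rw [this, card_insert_of_notMem hwL]
      omega
    unfold deg at hcard
    omega
  have hsum := sum_offDeg_add_attach H w
  rw [ht] at hsum
  have hAt : attach H w ≤ t := by
    have := attach_le H hfree w
    omega
  have hP := sum_offDeg_mul_pred_le H w L hwL
  have htan : ∀ x ∈ L, 2 * q * offDeg H w x ≤ offDeg H w x * (offDeg H w x - 1) + q * (q + 1) :=
    fun x _ => two_mul_le_mul_pred_add _ q
  have hsum2 := sum_le_sum htan
  rw [sum_add_distrib, sum_const, smul_eq_mul, ← mul_sum] at hsum2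
  have hkey := (layer_value_iff H s t j hm w hw ht).mp hS
  rw [← hLcard]
  have ett : t * (t + 1) = t * (t - 1) + 2 * t := by
    rcases Nat.eq_zero_or_pos t with rfl | hpos
    · rfl
    · obtain ⟨t', rfl⟩ : ∃ t', t = t' + 1 := ⟨t - 1, by omega⟩
      rw [Nat.add_sub_cancel]
      ring
  -- `2 j = t (t + 1) − 2 att − P`, `P ≥ 2 q (2 t − att) − |L| q (q + 1)`, `att (q − 1) ≤ t (q − 1)`
  obtain ⟨q', rfl⟩ : ∃ q', q = q' + 1 := ⟨q - 1, by omega⟩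
  nlinarith [hsum2, hP, hkey, hsum, hAt, ett]

end C047

end TriangleCap

end PercRepro
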